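/-
Refuter work file (cdisprove-style) for the crux `KrwChromaticSteering.StrongComposition`
(stmt-PneNP-18538), route `route-PneNP-KrwChromaticSteering`.  Seat pnp-krw-ref-1, 2026-08-27.
Sorry-free.  Published with `ledger crux write stmt-PneNP-18538 Disproof.lean`.
-/
import Summits.PneNP.PneNP.Theses.KrwChromaticSteering
import Summits.PneNP.PneNP.Theorems.KrwChromaticSteeringCompositionIterationIterate
import Summits.PneNP.PneNP.Cruxes.StrongComposition.Lines.birth

/-!
# Disproof attempt on `StrongComposition` (C1) — findings

**Verdict (2026-08-27): SURVIVES as typed — no kill.**  `StrongComposition` (C1) together with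
`StandardFromStrong` (C2) is *exactly* the weak KRW conjecture in depth form (`WeakKRW` below =
the hypothesis of `CompositionIteration` = Meir 2023, Conj. 2, p. 3: `D(f ⋄ g) ≥ D(f) + n − O(log mn)`
for some `g`, for every non-constant `f`): `weakKRW_iff_cruxes`.  Hence any unconditional `¬ C1`
or `¬ C2` would refute weak KRW, an open conjecture with no counterexample family in print
(de Rezende–Meir–Nordström–Pitassi–Robere 2020, §1.2 "obstacle 1" is prose about the *same-`g`*
form only; Chen–Kabanets–… STACS 2025 (arXiv:2410.10189, Thm 3 / Cor 2) is a LOWER bound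
`n^{3-o(1)}` for `XOR ∘ f`, not a saving).  The `∃ c · (⌊log₂ (m n)⌋ + 1)` slack absorbs every fixed
`(m, n)`, so finite brute force can inform but never refute (§4).

## Contents
* §0 `WeakKRW` and the exact split `WeakKRW ↔ StrongComposition ∧ StandardFromStrong`
  (`strongComposition_of_weakKRW`, `standardFromStrong_of_weakKRW`, `weakKRW_of_cruxes`);
  the "send your input" `KW_g` protocol of depth `n + ⌊log₂ n⌋ + 1` (`exists_solves_sendInput`).
* §1 Load-bearing hypotheses of C1: non-constancy of `f` IS load-bearing
  (`strongComposition_false_without_nonconst`, witness `m = 1`, `f ≡ true`, `n = 2^t`);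
  `1 ≤ n` is NOT (`strongCompositionAnyN_iff`: at `n = 0` the protocol type is empty).
* §2 Natural strengthenings: the `∀ g` form is FALSE (`not_strongCompositionForallG`, witness
  `m = 1`, `f = g =` dictator, the depth-0 leaf protocol); the `O(1)`-loss form is false modulo the
  printed Gaskov–Lozhkin depth bound `D(g) ≤ n − log₂ log₂ n + O(1)`
  (`strongCompositionConstLoss_false_of_gaskovLozhkin`; `H` stated as `GaskovLozhkinDepthBound`).
* §3 The line's lever: `SteeredTranscript ⟸ StrongComposition` is trivial
  (`steeredTranscript_of_strongComposition`), so given the two M/L stubs the lever is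
  crux-EQUIVALENT and cannot be refuted short of `¬ C1`; Meir 2023 §7 Prop. 9 hand-check (docstring
  of `steeredTranscript_of_strongComposition`): Prop. 9 blocks density-live chromatic lower bounds
  at `γ ≥ 0.64`, it does not produce a protocol beating `D(f) + n − O(log mn)`.
* §4 Small cases (kit job `j281476`, exact): at `(m, n) = (2, 2)` every non-constant pair has
  `C(KW_f ⊛ KW_g) = C(KW_{f ⋄ g}) = C(KW_f) + C(KW_g)` (loss 0, strong = standard); `(2,3)`, `(3,2)`,
  `(2,4)`, `(3,3)` tables in the job's `TABLES.md` (evidence on both items).  Documentation only.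

## HANDOFF (for the next refuter seat)
Landed under `Theorems/StrongComposition/Negative/`: see the item's evidence notes (proposal ids).
Not tried / next regimes: (i) a same-`g` saving family `C(KW_f ⊛ KW_g) < C(KW_f) + n − ω(log mn)`
for ONE explicit hard `g` would not refute C1 (C1 chooses `g`) — do not spend time there;
(ii) the only route to `¬ C1` is `¬ WeakKRW`; (iii) informative: which `g` maximise the strong game
at `(3,3)` (job tables) — compare with the line's MUX steering.
-/

set_option linter.dupNamespace false
set_option autoImplicit false

namespace Summit.PneNP.PneNP.Cruxes.StrongComposition.Disproof

open Literature.Computability.Complexity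
open Summit.PneNP.PneNP.Theorems.KrwCompositionIteration (exists_mul_succ_lt_two_pow)

universe u

/-! ## §0  Weak KRW (depth form) and the split `WeakKRW ↔ C1 ∧ C2` -/

/-- **Weak KRW conjecture, depth form** — verbatim the hypothesis of the route's assembly item
`CompositionIteration`: for every non-constant outer `f` SOME inner `g` makes the block composition
lose at most `O(log (m n))` below `D(f) + n`. [cite: Meir2023, Conjecture 2 (§1)] -/
def WeakKRW : Prop :=
  ∃ c : ℕ, ∀ m n : ℕ, 1 ≤ n → ∀ f : (Fin m → Bool) → Bool, (∃ a b, f a ≠ f b) →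
    ∃ g : (Fin n → Bool) → Bool, ∀ P : KWTree (Fin m × Fin n), P.Solves (blockComp f g) →
      ∃ Q : KWTree (Fin m), Q.Solves f ∧ Q.depth + n ≤ P.depth + c * (Nat.log 2 (m * n) + 1)

/-- The assembly item is literally `WeakKRW → (∃ L ∈ P, L ∉ NC¹)`. -/
theorem compositionIteration_iff :
    Summit.PneNP.PneNP.Theses.KrwChromaticSteering.CompositionIteration ↔
      (WeakKRW → ∃ L ∈ Literature.Computability.Complexity.Classes.P,
        L ∉ Literature.Computability.Complexity.NC1) :=
  Iff.rfl

/-- `WeakKRW → C1`: a strong protocol is in particular a standard one (`SolvesStrong.solves`), so the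
weak-KRW `g` works for the strong game with the same constant. -/
theorem strongComposition_of_weakKRW (h : WeakKRW) :
    Summit.PneNP.PneNP.Theses.KrwChromaticSteering.StrongComposition := by
  obtain ⟨c, h⟩ := h
  refine ⟨c, fun m n hn f hf => ?_⟩
  obtain ⟨g, hg⟩ := h m n hn f hf
  exact ⟨g, fun P hP => hg P hP.solves⟩

/-- `C1 ∧ C2 → WeakKRW` — the route's glue (`closes`), recorded here so that the split is an `iff`. -/
theorem weakKRW_of_cruxes
    (h1 : Summit.PneNP.PneNP.Theses.KrwChromaticSteering.StrongComposition)
    (h2 : Summit.PneNP.PneNP.Theses.KrwChromaticSteering.StandardFromStrong) : WeakKRW := by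
  obtain ⟨c₁, h1⟩ := h1
  obtain ⟨c₂, h2⟩ := h2
  refine ⟨c₁ + c₂, fun m n hn f hf => ?_⟩
  obtain ⟨g, hg⟩ := h1 m n hn f hf
  obtain ⟨g₀, hg₀⟩ := h2 m n hn f hf
  refine ⟨g₀, fun P hP => ?_⟩
  obtain ⟨P', hP', hd'⟩ := hg₀ g P hP
  obtain ⟨Q, hQ, hdQ⟩ := hg P' hP'
  refine ⟨Q, hQ, ?_⟩
  have hsplit : (c₁ + c₂) * (Nat.log 2 (m * n) + 1)
      = c₁ * (Nat.log 2 (m * n) + 1) + c₂ * (Nat.log 2 (m * n) + 1) := by ring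
  omega

/-! ### The "send your input" protocol for `KW_g` (depth `n + ⌊log₂ n⌋ + 1`) -/

section SendInput

variable {ι : Type u} [DecidableEq ι]

/-- The assignment `a` restricted to the listed coordinates (`false` elsewhere). -/
def restrictTo (l : List ι) (a : ι → Bool) : ι → Bool := fun j => if j ∈ l then a j else false

/-- Alice announces her bits at the listed coordinates, one round each, then the play continues in
`T w` where `w` records the announced bits. [folklore] -/
def aliceSend : List ι → ((ι → Bool) → KWTree ι) → KWTree ι
  | [], T => T fun _ => false
  | i :: l, T =>
      KWTree.alice (fun a => a i) (aliceSend l fun w => T (Function.update w i false))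
        (aliceSend l fun w => T (Function.update w i true))

omit [DecidableEq ι] in
private theorem update_restrictTo (l : List ι) (a : ι → Bool) (i : ι) [DecidableEq ι] :
    Function.update (restrictTo l a) i (a i) = restrictTo (i :: l) a := by
  funext j
  by_cases hj : j = i
  · subst hj; simp [restrictTo]
  · simp [restrictTo, hj]

/-- Run law of `aliceSend`. [folklore] -/
theorem run_aliceSend : ∀ (l : List ι) (T : (ι → Bool) → KWTree ι) (a b : ι → Bool),
    (aliceSend l T).run a b = (T (restrictTo l a)).run a b
  | [], T, a, b => by
    have : restrictTo ([] : List ι) a = fun _ => false := by funext j; simp [restrictTo]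
    simp [aliceSend, this]
  | i :: l, T, a, b => by
    simp only [aliceSend, KWTree.run_alice]
    cases hai : a i
    · simp only [Bool.false_eq_true, ↓reduceIte]
      rw [run_aliceSend l _ a b, ← update_restrictTo l a i, hai]
    · simp only [↓reduceIte]
      rw [run_aliceSend l _ a b, ← update_restrictTo l a i, hai]

/-- Depth law of `aliceSend`: `|l|` rounds plus the deepest continuation. [folklore] -/
theorem depth_aliceSend_le : ∀ (l : List ι) (T : (ι → Bool) → KWTree ι) (D : ℕ),
    (∀ w, (T w).depth ≤ D) → (aliceSend l T).depth ≤ l.length + D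
  | [], T, D, h => by simpa [aliceSend] using h _
  | i :: l, T, D, h => by
    have h0 := depth_aliceSend_le l (fun w => T (Function.update w i false)) D fun w => h _
    have h1 := depth_aliceSend_le l (fun w => T (Function.update w i true)) D fun w => h _
    simp only [aliceSend, KWTree.depth_alice, List.length_cons]
    omega

end SendInput

/-- The number of a coordinate where `u` and `v` differ (`0` if none). -/
noncomputable def firstDiff {n : ℕ} (u v : Fin n → Bool) : ℕ :=
  if h : ∃ i : Fin n, u i ≠ v i then ((Classical.choose h : Fin n) : ℕ) else 0

/-- `ℕ → Fin n` with junk value `⟨0, _⟩` out of range (needs `1 ≤ n`). -/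
def eltOf {n : ℕ} (hn : 1 ≤ n) (l : ℕ) : Fin n := if h : l < n then ⟨l, h⟩ else ⟨0, hn⟩

/-- Bob's stage once he knows Alice's input `u`: he names a differing coordinate in
`⌊log₂ n⌋ + 1` rounds. -/
noncomputable def bobStage {n : ℕ} (hn : 1 ≤ n) (u : Fin n → Bool) : KWTree (Fin n) :=
  KWTree.bobChoose (Nat.log 2 n + 1) (firstDiff u) fun l => KWTree.leaf (eltOf hn l)

/-- **The trivial `KW_g` protocol**: Alice sends her whole input (`n` rounds), Bob names a differing
coordinate (`⌊log₂ n⌋ + 1` rounds): every `g : {0,1}ⁿ → {0,1}` has `D(KW_g) ≤ n + ⌊log₂ n⌋ + 1`.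
[folklore; cite: KarchmerWigderson1990, §2 (trivial upper bound)] -/
theorem exists_solves_sendInput {n : ℕ} (hn : 1 ≤ n) (g : (Fin n → Bool) → Bool) :
    ∃ R : KWTree (Fin n), R.Solves g ∧ R.depth ≤ n + (Nat.log 2 n + 1) := by
  classical
  refine ⟨aliceSend (List.finRange n) (bobStage hn), ?_, ?_⟩
  · intro u v hu hv
    have hres : restrictTo (List.finRange n) u = u := by
      funext j; simp [restrictTo, List.mem_finRange]
    rw [run_aliceSend, hres]
    have hne : ∃ i : Fin n, u i ≠ v i := by
      by_contra hcon
      push Not at hcon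
      have huv : u = v := funext hcon
      rw [huv, hv] at hu
      exact Bool.false_ne_true hu
    have hfd : firstDiff u v = ((Classical.choose hne : Fin n) : ℕ) := by
      simp [firstDiff, dif_pos hne]
    have hlt : firstDiff u v < 2 ^ (Nat.log 2 n + 1) := by
      rw [hfd]
      exact lt_of_lt_of_le (Classical.choose hne).isLt (Nat.lt_pow_succ_log_self one_lt_two n).le
    simp only [bobStage]
    rw [KWTree.run_bobChoose _ _ _ u v hlt, KWTree.run_leaf, hfd]
    have helt : eltOf hn ((Classical.choose hne : Fin n) : ℕ) = Classical.choose hne := by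
      simp [eltOf]
    rw [helt]
    exact Classical.choose_spec hne
  · refine (depth_aliceSend_le _ _ (Nat.log 2 n + 1) fun w => ?_).trans ?_
    · exact KWTree.depth_bobChoose_le (Nat.log 2 n + 1) (firstDiff w)
        (fun l => KWTree.leaf (eltOf hn l)) 0 (fun j _ => by simp)
    · simp [List.length_finRange]

/-- A non-constant `f : {0,1}^m → {0,1}` forces `1 ≤ m`. -/
theorem one_le_of_nonconst {m : ℕ} {f : (Fin m → Bool) → Bool} (hf : ∃ a b, f a ≠ f b) : 1 ≤ m := by
  rcases Nat.eq_zero_or_pos m with rfl | hm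
  · obtain ⟨a, b, hab⟩ := hf
    exact absurd (congrArg f (Subsingleton.elim a b)) hab
  · exact hm

/-- `WeakKRW → C2` (with constant `c + 3`): turn the weak-KRW `KW_f` protocol `Q` (depth
`≤ D(P) + cL − n`) back into a STRONG protocol for `KW_f ⊛ KW_g`, for ANY `g`, by the obvious
protocol `compose g R Q` with `R` the trivial `KW_g` protocol (`n + ⌊log₂ n⌋ + 1` rounds):
depth `≤ D(P) + cL + ⌊log₂ n⌋ + 2 ≤ D(P) + (c + 3)·L`.  So C2, like C1, FOLLOWS from weak KRW. -/
theorem standardFromStrong_of_weakKRW (h : WeakKRW) :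
    Summit.PneNP.PneNP.Theses.KrwChromaticSteering.StandardFromStrong := by
  obtain ⟨c, h⟩ := h
  refine ⟨c + 3, fun m n hn f hf => ?_⟩
  obtain ⟨g₀, hg₀⟩ := h m n hn f hf
  refine ⟨g₀, fun g P hP => ?_⟩
  obtain ⟨Q, hQ, hQd⟩ := hg₀ P hP
  obtain ⟨R, hR, hRd⟩ := exists_solves_sendInput hn g
  refine ⟨KWTree.compose g R Q, KWTree.solvesStrong_compose hQ hR, ?_⟩
  rw [KWTree.depth_compose]
  have hm : 1 ≤ m := one_le_of_nonconst hf
  have hlog : Nat.log 2 n ≤ Nat.log 2 (m * n) :=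
    Nat.log_mono_right (Nat.le_mul_of_pos_left n hm)
  have hsplit : (c + 3) * (Nat.log 2 (m * n) + 1)
      = c * (Nat.log 2 (m * n) + 1) + 3 * (Nat.log 2 (m * n) + 1) := by ring
  omega

/-- **The exact split.**  The route's two cruxes are jointly EQUIVALENT to weak KRW (depth form):
neither can be refuted unconditionally without refuting Meir's Conjecture 2. -/
theorem weakKRW_iff_cruxes :
    WeakKRW ↔ (Summit.PneNP.PneNP.Theses.KrwChromaticSteering.StrongComposition ∧
      Summit.PneNP.PneNP.Theses.KrwChromaticSteering.StandardFromStrong) :=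
  ⟨fun h => ⟨strongComposition_of_weakKRW h, standardFromStrong_of_weakKRW h⟩,
    fun h => weakKRW_of_cruxes h.1 h.2⟩

/-! ## §1  Load-bearing hypotheses of C1 -/

/-- C1 with the non-constancy hypothesis on `f` DROPPED. -/
def StrongCompositionWithoutNonconst : Prop :=
  ∃ c : ℕ, ∀ m n : ℕ, 1 ≤ n → ∀ f : (Fin m → Bool) → Bool,
    ∃ g : (Fin n → Bool) → Bool, ∀ P : KWTree (Fin m × Fin n), P.SolvesStrong f g →
      ∃ Q : KWTree (Fin m), Q.Solves f ∧ Q.depth + n ≤ P.depth + c * (Nat.log 2 (m * n) + 1)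

/-- **Non-constancy of `f` is load-bearing**: for constant `f` the strong game is vacuous, the
depth-0 leaf protocol solves it, and `n ≤ c·(⌊log₂ n⌋ + 1)` fails at `n = 2^t`, `c (t+1) < 2^t`.
Witness: `m = 1`, `f ≡ true`. -/
theorem strongComposition_false_without_nonconst : ¬ StrongCompositionWithoutNonconst := by
  rintro ⟨c, h⟩
  obtain ⟨t, ht⟩ := exists_mul_succ_lt_two_pow c
  have hn : 1 ≤ 2 ^ t := Nat.one_le_two_pow
  obtain ⟨g, hg⟩ := h 1 (2 ^ t) hn (fun _ => true)
  obtain ⟨Q, -, hQ⟩ := hg (KWTree.leaf ((0 : Fin 1), (⟨0, hn⟩ : Fin (2 ^ t))))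
    (by intro X Y _ hY; simp at hY)
  rw [KWTree.depth_leaf, one_mul, Nat.log_pow one_lt_two] at hQ
  omega

/-- C1 with the hypothesis `1 ≤ n` DROPPED. -/
def StrongCompositionAnyN : Prop :=
  ∃ c : ℕ, ∀ m n : ℕ, ∀ f : (Fin m → Bool) → Bool, (∃ a b, f a ≠ f b) →
    ∃ g : (Fin n → Bool) → Bool, ∀ P : KWTree (Fin m × Fin n), P.SolvesStrong f g →
      ∃ Q : KWTree (Fin m), Q.Solves f ∧ Q.depth + n ≤ P.depth + c * (Nat.log 2 (m * n) + 1)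

/-- Over an empty coordinate type there is no protocol tree (every tree has a leaf). -/
theorem isEmpty_kwTree {ι : Type u} [h : IsEmpty ι] : IsEmpty (KWTree ι) :=
  ⟨fun P => by
    induction P with
    | leaf i => exact h.elim i
    | alice _ _ _ ih _ => exact ih
    | bob _ _ _ ih _ => exact ih⟩

/-- **`1 ≤ n` is NOT load-bearing**: at `n = 0` the type `KWTree (Fin m × Fin 0)` is empty, so the
`∀ P` is vacuous and the dropped-hypothesis form is equivalent to C1. (Information for the prover:
the hypothesis can be ignored; it is there for the informal reading only.) -/
theorem strongCompositionAnyN_iff :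
    StrongCompositionAnyN ↔ Summit.PneNP.PneNP.Theses.KrwChromaticSteering.StrongComposition := by
  constructor
  · rintro ⟨c, h⟩
    exact ⟨c, fun m n _ f hf => h m n f hf⟩
  · rintro ⟨c, h⟩
    refine ⟨c, fun m n f hf => ?_⟩
    rcases Nat.eq_zero_or_pos n with rfl | hn
    · refine ⟨fun _ => true, fun P => ?_⟩
      haveI : IsEmpty (Fin m × Fin 0) := by infer_instance
      exact (isEmpty_kwTree.false P).elim
    · exact h m n hn f hf

/-! ## §2  Natural strengthenings -/

/-- STRENGTHENING 1 (false): C1 for EVERY non-constant inner `g` instead of SOME `g`. -/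
def StrongCompositionForallG : Prop :=
  ∃ c : ℕ, ∀ m n : ℕ, 1 ≤ n → ∀ f : (Fin m → Bool) → Bool, (∃ a b, f a ≠ f b) →
    ∀ g : (Fin n → Bool) → Bool, (∃ u v, g u ≠ g v) →
      ∀ P : KWTree (Fin m × Fin n), P.SolvesStrong f g →
        ∃ Q : KWTree (Fin m), Q.Solves f ∧ Q.depth + n ≤ P.depth + c * (Nat.log 2 (m * n) + 1)

/-- The `∀ g` form implies C1 (a non-constant `g` exists once `1 ≤ n`). -/
theorem strongComposition_of_forallG (h : StrongCompositionForallG) :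
    Summit.PneNP.PneNP.Theses.KrwChromaticSteering.StrongComposition := by
  obtain ⟨c, h⟩ := h
  refine ⟨c, fun m n hn f hf => ⟨fun u => u ⟨0, hn⟩, fun P hP => ?_⟩⟩
  exact h m n hn f hf _ ⟨fun _ => true, fun _ => false, by simp⟩ P hP

/-- **The `∀ g` strengthening is FALSE**: for an EASY inner function the strong game is easy.
Witness: `m = 1`, `f a = a 0`, `g u = u 0` (dictators), `n = 2^t` with `c (t+1) < 2^t`; the depth-0
protocol `leaf (0, 0)` solves `KW_f ⊛ KW_g` (the entry `(0,0)` differs and so do the row labels),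
while the conclusion demands `n ≤ c·(t + 1)`.  Any proof of C1 must therefore CHOOSE a hard `g`
(the statement's `∃ g` is load-bearing, as the informal text says). -/
theorem not_strongCompositionForallG : ¬ StrongCompositionForallG := by
  rintro ⟨c, h⟩
  obtain ⟨t, ht⟩ := exists_mul_succ_lt_two_pow c
  have hn : 1 ≤ 2 ^ t := Nat.one_le_two_pow
  let j0 : Fin (2 ^ t) := ⟨0, hn⟩
  obtain ⟨Q, -, hQ⟩ := h 1 (2 ^ t) hn (fun a => a 0) ⟨fun _ => true, fun _ => false, by simp⟩
    (fun u => u j0) ⟨fun _ => true, fun _ => false, by simp⟩ (KWTree.leaf ((0 : Fin 1), j0))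
    (by
      intro X Y hX hY
      simp only [blockComp_apply, rowLabels_apply, row_apply] at hX hY
      simp only [KWTree.run_leaf, rowLabels_apply, row_apply, hX, hY, ne_eq, Bool.true_eq_false,
        not_false_eq_true, and_self])
  rw [KWTree.depth_leaf, one_mul, Nat.log_pow one_lt_two] at hQ
  omega

/-- HYPOTHESIS `H` for the next lemma (a printed theorem NOT yet in the tree): the uniform depth upper
bound `D(g) ≤ n − log₂ log₂ n + O(1)` for every `g : {0,1}ⁿ → {0,1}`.
[cite: Gaskov1978 (depth of Boolean functions); Lozhkin1983; see JuknaBFC2012, §1.4 / Thm 1.17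
(Lupanov-type bounds) for the size analogue] [topic: Computability/Complexity/FormulaDepth] -/
def GaskovLozhkinDepthBound : Prop :=
  ∃ c : ℕ, ∀ n : ℕ, 1 ≤ n → ∀ g : (Fin n → Bool) → Bool,
    ∃ R : KWTree (Fin n), R.Solves g ∧ R.depth + Nat.log 2 (Nat.log 2 n) ≤ n + c

/-- STRENGTHENING 2: C1 with loss `O(1)` instead of `O(log (m n))`. -/
def StrongCompositionConstLoss : Prop :=
  ∃ c : ℕ, ∀ m n : ℕ, 1 ≤ n → ∀ f : (Fin m → Bool) → Bool, (∃ a b, f a ≠ f b) →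
    ∃ g : (Fin n → Bool) → Bool, ∀ P : KWTree (Fin m × Fin n), P.SolvesStrong f g →
      ∃ Q : KWTree (Fin m), Q.Solves f ∧ Q.depth + n ≤ P.depth + c

/-- **The `O(1)`-loss form is false modulo Gaskov–Lozhkin.**  At `m = 1`, `f = ` dictator, the strong
game `KW_f ⊛ KW_g` is solved by the `KW_g` protocol played on row `0` (`onRow`), of depth
`D(g) ≤ n − log₂ log₂ n + c'`; the `O(1)` form would force `n ≤ D(P) + c`, i.e.
`log₂ log₂ n ≤ c + c'`, false at `n = 2^(2^(c+c'+1))`.  (The `O(log mn)` slack of C1 as typed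
absorbs exactly this.) -/
theorem strongCompositionConstLoss_false_of_gaskovLozhkin (hGL : GaskovLozhkinDepthBound) :
    ¬ StrongCompositionConstLoss := by
  rintro ⟨c, h⟩
  obtain ⟨c', hGL⟩ := hGL
  have hn : 1 ≤ 2 ^ (2 ^ (c + c' + 1)) := Nat.one_le_two_pow
  obtain ⟨g, hg⟩ := h 1 (2 ^ (2 ^ (c + c' + 1))) hn (fun a => a 0)
    ⟨fun _ => true, fun _ => false, by simp⟩
  obtain ⟨R, hR, hRd⟩ := hGL _ hn g
  obtain ⟨Q, -, hQ⟩ := hg (KWTree.onRow 0 R) (by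
    intro X Y hX hY
    simp only [blockComp_apply, rowLabels_apply] at hX hY
    refine ⟨?_, ?_⟩
    · simpa using hR (row X 0) (row Y 0) hX hY
    · simp [hX, hY])
  rw [KWTree.depth_onRow] at hQ
  rw [Nat.log_pow one_lt_two, Nat.log_pow one_lt_two] at hRd
  omega

/-- Upper side (tightness of the format): the obvious protocol gives
`C(KW_f ⊛ KW_g) ≤ D(Q) + D(R) + 1` for ANY protocols `Q ⊨ KW_f`, `R ⊨ KW_g` — so C1's conclusion
`D(Q) + n ≤ D(P) + cL` can only hold for `g` with `D(KW_g) ≥ n − cL − 1`: the chosen `g` must be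
depth-hard (cf. `DepthHardFunctionsExist_holds`, `c = 8`). [cite: Meir2023, §1] -/
theorem exists_solvesStrong_depth_eq {m n : ℕ} {f : (Fin m → Bool) → Bool}
    {g : (Fin n → Bool) → Bool} {Q : KWTree (Fin m)} {R : KWTree (Fin n)}
    (hQ : Q.Solves f) (hR : R.Solves g) :
    ∃ P : KWTree (Fin m × Fin n), P.SolvesStrong f g ∧ P.depth = Q.depth + R.depth + 1 :=
  ⟨KWTree.compose g R Q, KWTree.solvesStrong_compose hQ hR, KWTree.depth_compose g R Q⟩

/-! ## §3  The line's lever versus the crux; Meir §7 Prop. 9 -/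

open Summit.PneNP.PneNP.Cruxes.StrongComposition.Birth in
/-- **The lever follows from the crux, trivially** (pad `π` to length `d`, use the `y`-disjunct,
whose right-hand side only grows with `log₂ log₂ χ`).  With the line's two provable stubs
(`ResidualRectangle`, `ChromaticEndgame`) giving the converse (`strongComposition_of_sigs`), the
lever `SteeredTranscript` is EQUIVALENT to C1: it cannot be refuted without refuting C1 (hence weak
KRW, §0), and "cheap falsifiers" can only bear on HOW it might be proven.

**Meir 2023 §7 Prop. 9, hand-checked against the lever** (arXiv:2306.00615 pp. 30–32).  Setting:
`m ≥ 2n`, `L(f) ≥ 2^m / m` (so `m − log₂ m ≤ D(f) ≤ m + log₂ m + 1`), inner game `MUX_n`; Meir's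
transcript `π₁`: Alice and Bob announce the numbers of ones in the first columns of `X`, `Y`
(`⌊0.08m⌋`, `⌈0.92m⌉`; `≈ log₂ m` bits each) and the cosets of `a = g(X)`, `b = g(Y)` modulo a
Varshamov code `C` (distance `0.161m`, `dim C ≥ 0.362m`; `≤ 0.638m` bits each), the same coset `W`
being the one maximising `L(𝒜_W × f⁻¹(0))`.  Hand-check: (1) `|π₁| ≤ 1.276m + 2 log₂ m + O(1)`;
(2) `χ(G_{π₁}) = 1` (no weak-intersection edges: `X`, `Y` disagree on `≥ 0.84m` rows while
`a − b ∈ C` has `≥ 0.161m` ones) — so the CHROMATIC (`y`-) certificate of the lever at `π₁` reads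
`D(f) + n ≤ |π₁| + 0 + cL`, true iff `n ≲ 0.28m + 3 log₂ m + cL`: it FAILS on
`0.28m + O(log m) < n ≤ m/2`; (3) the residual rectangle `𝒜_W × ℬ_W` has
`0.362m − log₂ m − 1 ≤ log₂ L ≤ C(𝒜_W × ℬ_W) ≤ dim C + log₂ m + 1` (Alice sends her coordinates
inside the coset, Bob names a differing row), so the RECTANGLE (`x`-) certificate at `π₁` reads
`D(f) + n ≤ |π₁| + C(𝒜_W × ℬ_W) + cL ≈ 1.64m + O(log m) + cL`, which HOLDS for every `n ≤ 0.63m`,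
in particular throughout Prop. 9's regime `n ≤ m/2`: `π₁` is a wasteful prefix, and wasteful
prefixes certify.  (4) Independently of (2)–(3): the lever quantifies `∃ π` over prefixes of the
family, and the full-length transcript of any `F g₀` of depth `≥ D(f) + n − cL` certifies; Prop. 9
exhibits ONE live prefix with trivial characteristic graph inside a protocol `Π` that is otherwise
arbitrary ("any protocol that solves `KW_f ⊛ MUX_n` with that 4-message prefix"), so it says
nothing about `min_Π depth`.  CONCLUSION: Prop. 9 is a barrier for proofs of the form "every
`γ`-live transcript has `log log χ(G_π) ≳ n`" at `γ ≥ 0.64` (the route's thesis acknowledges this and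
proposes to STEER the transcript instead); it neither refutes C1 / the lever as typed nor supports
them.  Quantitative residue for the prover: a steering argument must produce its `+n` from prefixes
at which BOTH `|π| + C(𝒜_π × ℬ_π) < D(f) + n − cL` and `χ(G_π)` is small — Prop. 9 shows such
prefixes exist at density-liveness `0.64`, so liveness alone cannot be the steering invariant. -/
theorem steeredTranscript_of_strongComposition
    (h : Summit.PneNP.PneNP.Theses.KrwChromaticSteering.StrongComposition) :
    SteeredTranscript := by
  obtain ⟨c, h⟩ := h
  refine ⟨c, fun m n hn f hf F d hF hd => ?_⟩
  obtain ⟨g, hg⟩ := h m n hn f hf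
  obtain ⟨Q, hQ, hQd⟩ := hg (F g) (hF g)
  refine ⟨List.replicate d false, by simp, Or.inr ⟨Q, hQ, ?_⟩⟩
  have hdg := hd g
  simp only [List.length_replicate]
  omega

open Summit.PneNP.PneNP.Cruxes.StrongComposition.Birth in
/-- Hence, given the line's two M/L stubs as hypotheses, lever and crux are equivalent. -/
theorem steeredTranscript_iff_strongComposition (hRR : ResidualRectangle) (hCE : ChromaticEndgame) :
    SteeredTranscript ↔ Summit.PneNP.PneNP.Theses.KrwChromaticSteering.StrongComposition :=
  ⟨fun hST => strongComposition_of_sigs hRR hCE hST, steeredTranscript_of_strongComposition⟩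

/-! ## §4  Small cases (documentation)

Kit job `j281476` (tag pnp-ideate; exact, three engines cross-checked at `(2,2)`: rectangle
recursion = SAT protocol search = De Morgan formula depth): for `(m, n) = (2, 2)` and EVERY pair of
non-constant `f, g`: `C(KW_f ⊛ KW_g) = C(KW_{f ⋄ g}) = C(KW_f) + C(KW_g)` — weak-KRW loss `0`,
C1-loss `0`, C2-gap `0`, and the obvious protocol's `+1` is never needed.  Larger tables
(`(2,3)`, `(3,2)` strong and standard; `(2,4)`, `(3,3)` standard) are in the job's `TABLES.md`,
attached as evidence to stmt-PneNP-18538 / 18539.  As the module docstring says, no finite table can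
refute an `∃ c · (⌊log₂ (m n)⌋ + 1)` statement; the tables calibrate the line (which `g` are the
hardest inner functions for the strong game at tiny size) and nothing more. -/

end Summit.PneNP.PneNP.Cruxes.StrongComposition.Disproof
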